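import Literature.MathematicalPhysics.QuantumFieldTheory.Balaban1983to89.B5RealFields
import HarnessLib

/-!
# Route «BalabanUVNodes» (K3⁷), node N15 = NE2, -a lane, PROGRAMME N file N-Ia: BLOCK-FACE REFLECTIONS OF THE b05 TORUS — the point map, «blocks go to blocks»,
# and the reflection operators on scalar functions and on 1-forms (with the bond twist)

Cell `pub-ymgap`, seat `pub-ymgap-dag-n15-a` (KNIT-BY-NAME, g19; D-0062; chair R424 venue; `bears_on: R4∕N15`); `--kind proof --supports stmt-QuantumFields-20544 --as helper`.

WHY.  [Balaban1984PropagatorsII] (2.37) p. 229 builds the parametrix of the random-walk expansion from CUBE propagators «`G′(□)` … an inverse of `Δ′_a` with some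
boundary conditions on the boundary of `□`, e.g. with Neumann boundary conditions as in [3]» ([3] = [Balaban1983RegularityDecay]: Neumann conditions by REFLECTION).
dag-n15-c's two-spacing gluing files (`…N15TwoSpacingGluing*`, pub-ymgap INBOX l.26565∕l.26902∕l.27050) take an ABSTRACT per-cube operator with the locality
hypothesis `M_h ∘ Δ_a ∘ G_□ = M_h` and ask this lane for the `U ≡ 1` cube propagator and its gluing letters.  The Neumann-by-images cube propagator on King's torus
carrier (file N-III) is a signed∕unsigned sum of REFLECTED copies of the torus propagator `gOp`; everything rests on ONE fact, typed here: the b05 operator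
`DeltaA n M a = Lap − GradOp·PcT·GradOpᴴ + a•QvAdj·QvOp` ([Balaban1984PropagatorsI] (1.69)∕(1.73), `B5DeltaA169`) COMMUTES with the reflection of the torus
`T_η = Tor (fine n M)` in a BLOCK FACE, acting on 1-forms with the bond twist (the `κ`-component is a `κ`-bond: reversing it moves its start point by one lattice
step and flips its sign).

WHAT (this file = §0–§2; the equivariance of the b05 letters and of `Δ_a`, `G = Δ_a⁻¹` is the sequel N-Ib `…N15TorusReflectionsDeltaA`).  §1 the point reflection `torRefl N κ x = (…, −1 − x_κ, …)` (a block face lies between the lattice hyperplanes `x_κ = −1` and `x_κ = 0`), its linear part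
`torNeg`, involutivity, the translation rules `torRefl (x + v) = torRefl x + torNeg v`; `torRefl (bpt y j) = bpt (torRefl y) (flip j)` (blocks go to blocks, the
in-block coordinate `j_κ ↦ n − 1 − j_κ`).  §2 the scalar reflection matrix `reflS` (`(reflS f)(x) = f(σx)`) and the 1-form reflection `reflV` (`(reflV A)(x, μ) = A(σx, μ)`
for `μ ≠ κ`, `(reflV A)(x, κ) = −A(σx − e_κ, κ)`); both are real symmetric involutions (`reflS_mul_reflS`, `reflV_mul_reflV`, `reflS_transpose`, `reflV_transpose`), with the adjoint transport lemma
`conjTranspose_comm_of_comm` (`R₁X = XR₂ ⇒ R₂Xᴴ = XᴴR₁`) that moves an equivariance from `Q` to `Q*`, from `∂` to `∂*`.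
HONEST FRAMING.  Finite-dimensional lattice algebra (index bijections on finite tori); no estimate; `U ≡ 1` torus MODEL of [B5] §1; nothing of [B6]∕[B9] asserted; N15 NOT
discharged (object-bound; NE2⁺ NOT PRINTED); counts UNMOVED (typed 28∕28 · discharged 5∕27); one finite torus at fixed lattice spacing — NOT continuum ∕ ℝ⁴ ∕ OS ∕ mass
gap ∕ Clay.  Plumbing defs are DATA (two point maps, two matrices, one real linear map); every theorem is [folklore] lattice algebra about printed objects.
-/

noncomputable section

open scoped BigOperators Matrix ComplexConjugate
open Finset

namespace Summit.QuantumFields.YangMills.BalabanUVNodes.N15.TwoGrid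

open Literature.MathematicalPhysics.QuantumFieldTheory.Balaban1983to89
open Literature.MathematicalPhysics.QuantumFieldTheory.Balaban1983to89.B5Prop11Plancherel (Tor fine unitVec shiftM fdiff)
open Literature.MathematicalPhysics.QuantumFieldTheory.Balaban1983to89.B5Block118 (tstep up upHom iota bpt lineSum QsOp QvOp QsOp_mulVec QvOp_mulVec tstep_succ)
open Literature.MathematicalPhysics.QuantumFieldTheory.Balaban1983to89.B5Action121 (shiftS sdiff sdiff_mulVec GradOp GradOp_mulVec LapS LapS_mulVec LapV)
open Literature.MathematicalPhysics.QuantumFieldTheory.Balaban1983to89.B5Prop11Lower (Lap)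
open Literature.MathematicalPhysics.QuantumFieldTheory.Balaban1983to89.B5LaplaceInverse (LapSinv Pker LapS_mul_LapSinv LapSinv_mul_LapS LapSinv_mul_Pker
  Pker_mul_LapSinv Pker_const Pker_orth)
open Literature.MathematicalPhysics.QuantumFieldTheory.Balaban1983to89.B5Substitution125 (Mop Cavg Kmat Minv Kmat_isUnit)
open Literature.MathematicalPhysics.QuantumFieldTheory.Balaban1983to89.B5Projection127 (Pc)
open Literature.MathematicalPhysics.QuantumFieldTheory.Balaban1983to89.B5Value126 (PcT)
open Literature.MathematicalPhysics.QuantumFieldTheory.Balaban1983to89.B5DeltaA169 (DeltaA QvAdj isUnit_DeltaA)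
open Literature.MathematicalPhysics.QuantumFieldTheory.Balaban1983to89.B5RealFields (IsReal reM GR DeltaAR isReal_DeltaA)

variable {d : ℕ}

/-! ## §0 Two generic matrix facts -/

section Generic

/-- Two complex matrices with the same action on every vector are equal. [folklore] -/
theorem matrix_eq_of_mulVec_eq {m k : Type} [Fintype k] [DecidableEq k] {A B : Matrix m k ℂ} (h : ∀ v, A *ᵥ v = B *ᵥ v) : A = B :=
  Matrix.toLin'.injective (LinearMap.ext fun v => by rw [Matrix.toLin'_apply, Matrix.toLin'_apply, h v])

/-- A matrix commuting with an invertible matrix commutes with its inverse. [folklore] -/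
theorem mul_nonsing_inv_comm {m : Type} [Fintype m] [DecidableEq m] {A R : Matrix m m ℂ} (hA : IsUnit A.det) (h : R * A = A * R) : R * A⁻¹ = A⁻¹ * R := by
  calc R * A⁻¹ = (A⁻¹ * A) * (R * A⁻¹) := by rw [Matrix.nonsing_inv_mul _ hA, Matrix.one_mul]
    _ = A⁻¹ * (A * R) * A⁻¹ := by simp only [Matrix.mul_assoc]
    _ = A⁻¹ * (R * A) * A⁻¹ := by rw [h]
    _ = A⁻¹ * R * (A * A⁻¹) := by simp only [Matrix.mul_assoc]
    _ = A⁻¹ * R := by rw [Matrix.mul_nonsing_inv _ hA, Matrix.mul_one]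

end Generic

/-! ## §1 The block-face reflection of the torus and its linear part -/

section Points

variable (N : Fin d → ℕ) (κ : Fin d)

/-- The LINEAR reflection `v ↦ (…, −v_κ, …)` of the torus `Π_μ ℤ∕N_μ` in direction `κ`. [folklore] -/
def torNeg (v : Tor N) : Tor N := Function.update v κ (-v κ)

/-- **THE BLOCK-FACE REFLECTION** `x ↦ (…, −1 − x_κ, …)`: the reflection of the lattice torus in the hyperplane between the lattice hyperplanes `x_κ = −1` and `x_κ = 0`
(a face of every block decomposition whose block side divides `N_κ`). [cite: Balaban1984PropagatorsII, (2.37) p.229 («Neumann boundary conditions as in [3]»: reflections)] -/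
def torRefl (x : Tor N) : Tor N := Function.update x κ (-1 - x κ)

variable {N κ}

/-- `(torNeg v)_κ = −v_κ`. [folklore] -/
@[simp] theorem torNeg_apply_same (v : Tor N) : torNeg N κ v κ = -v κ := by simp [torNeg]
/-- `(torNeg v)_μ = v_μ` for `μ ≠ κ`. [folklore] -/
@[simp] theorem torNeg_apply_ne (v : Tor N) {μ : Fin d} (h : μ ≠ κ) : torNeg N κ v μ = v μ := by simp [torNeg, h]
/-- `(σx)_κ = −1 − x_κ`. [folklore] -/
@[simp] theorem torRefl_apply_same (x : Tor N) : torRefl N κ x κ = -1 - x κ := by simp [torRefl]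
/-- `(σx)_μ = x_μ` for `μ ≠ κ`. [folklore] -/
@[simp] theorem torRefl_apply_ne (x : Tor N) {μ : Fin d} (h : μ ≠ κ) : torRefl N κ x μ = x μ := by simp [torRefl, h]

/-- `σ(σx) = x`. [folklore] -/
@[simp] theorem torRefl_torRefl (x : Tor N) : torRefl N κ (torRefl N κ x) = x := by
  funext μ; by_cases h : μ = κ
  · subst h; simp
  · simp [h]

/-- `−(−v) = v`. [folklore] -/
@[simp] theorem torNeg_torNeg (v : Tor N) : torNeg N κ (torNeg N κ v) = v := by
  funext μ; by_cases h : μ = κ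
  · subst h; simp
  · simp [h]

/-- `σ` is injective. [folklore] -/
theorem torRefl_injective : Function.Injective (torRefl N κ) :=
  Function.Involutive.injective (torRefl_torRefl (N := N) (κ := κ))

/-- `σ` is bijective. [folklore] -/
theorem torRefl_bijective : Function.Bijective (torRefl N κ) :=
  Function.Involutive.bijective (torRefl_torRefl (N := N) (κ := κ))

/-- `σ x = y ↔ x = σ y`. [folklore] -/
theorem torRefl_eq_iff (x y : Tor N) : torRefl N κ x = y ↔ x = torRefl N κ y := by
  constructor
  · rintro rfl; simp
  · rintro rfl; simp

/-- `σ(x + v) = σx + (−v_κ-reflected v)`: the reflection is affine with linear part `torNeg`. [folklore] -/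
theorem torRefl_add (x v : Tor N) : torRefl N κ (x + v) = torRefl N κ x + torNeg N κ v := by
  funext μ; by_cases h : μ = κ
  · subst h; simp only [torRefl_apply_same, Pi.add_apply, torNeg_apply_same]; ring
  · simp [h]

/-- `σ(x − v) = σx − torNeg v`. [folklore] -/
theorem torRefl_sub (x v : Tor N) : torRefl N κ (x - v) = torRefl N κ x - torNeg N κ v := by
  funext μ; by_cases h : μ = κ
  · subst h; simp only [torRefl_apply_same, Pi.sub_apply, torNeg_apply_same]; ring
  · simp [h]

/-- `torNeg` is additive. [folklore] -/
theorem torNeg_add (v w : Tor N) : torNeg N κ (v + w) = torNeg N κ v + torNeg N κ w := by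
  funext μ; by_cases h : μ = κ
  · subst h; simp only [torNeg_apply_same, Pi.add_apply]; ring
  · simp [h]

/-- The linear reflection FLIPS the unit vector of its own direction … [folklore] -/
@[simp] theorem torNeg_unitVec_same : torNeg N κ (unitVec N κ) = -unitVec N κ := by
  funext μ; by_cases h : μ = κ
  · subst h; simp [unitVec]
  · simp [h, unitVec]

/-- … and FIXES the others. [folklore] -/
@[simp] theorem torNeg_unitVec_ne {μ : Fin d} (h : μ ≠ κ) : torNeg N κ (unitVec N μ) = unitVec N μ := by
  funext ν; by_cases hν : ν = κ
  · subst hν; simp [unitVec, Pi.single_eq_of_ne (Ne.symm h)]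
  · simp [hν]

/-- `torNeg (t·e_μ) = t·e_μ` for `μ ≠ κ`. [folklore] -/
@[simp] theorem torNeg_tstep_ne {μ : Fin d} (h : μ ≠ κ) (t : ℕ) : torNeg N κ (tstep N μ t) = tstep N μ t := by
  funext ν; by_cases hν : ν = κ
  · subst hν; simp [tstep, Ne.symm h]
  · simp [hν]

/-- `torNeg (t·e_κ) = −t·e_κ`. [folklore] -/
@[simp] theorem torNeg_tstep_same (t : ℕ) : torNeg N κ (tstep N κ t) = -tstep N κ t := by
  funext ν; by_cases hν : ν = κ
  · subst hν; simp [tstep]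
  · simp [hν, tstep]

/-- `σ(x + e_κ) = σx − e_κ`. [folklore] -/
theorem torRefl_add_unitVec_same (x : Tor N) : torRefl N κ (x + unitVec N κ) = torRefl N κ x - unitVec N κ := by
  rw [torRefl_add, torNeg_unitVec_same, ← sub_eq_add_neg]

/-- `σ(x − e_κ) = σx + e_κ`. [folklore] -/
theorem torRefl_sub_unitVec_same (x : Tor N) : torRefl N κ (x - unitVec N κ) = torRefl N κ x + unitVec N κ := by
  rw [torRefl_sub, torNeg_unitVec_same, sub_neg_eq_add]

/-- `σ(x ± e_μ) = σx ± e_μ` for `μ ≠ κ`. [folklore] -/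
theorem torRefl_add_unitVec_ne (x : Tor N) {μ : Fin d} (h : μ ≠ κ) : torRefl N κ (x + unitVec N μ) = torRefl N κ x + unitVec N μ := by
  rw [torRefl_add, torNeg_unitVec_ne h]

/-- `σ(x − e_μ) = σx − e_μ` for `μ ≠ κ`. [folklore] -/
theorem torRefl_sub_unitVec_ne (x : Tor N) {μ : Fin d} (h : μ ≠ κ) : torRefl N κ (x - unitVec N μ) = torRefl N κ x - unitVec N μ := by
  rw [torRefl_sub, torNeg_unitVec_ne h]

/-- `Σ_x f(σx) = Σ_x f(x)`. [folklore] -/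
theorem sum_torRefl [∀ μ, NeZero (N μ)] {α : Type} [AddCommMonoid α] (f : Tor N → α) : ∑ x, f (torRefl N κ x) = ∑ x, f x :=
  Function.Bijective.sum_comp torRefl_bijective f

end Points

/-! ## §1b Blocks go to blocks: `σ(n·y + j) = n·σ̃y + flip j` -/

section Blocks

variable (n : ℕ) (M : Fin d → ℕ) (κ : Fin d)

/-- The in-block coordinate flip `j_κ ↦ n − 1 − j_κ`. [folklore] -/
def flipIdx (j : Fin d → Fin n) : Fin d → Fin n := Function.update j κ (Fin.rev (j κ))

variable {n M κ}

/-- `(flip j)_κ = n − 1 − j_κ`. [folklore] -/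
@[simp] theorem flipIdx_apply_same (j : Fin d → Fin n) : flipIdx n κ j κ = Fin.rev (j κ) := by simp [flipIdx]
/-- `(flip j)_μ = j_μ` for `μ ≠ κ`. [folklore] -/
@[simp] theorem flipIdx_apply_ne (j : Fin d → Fin n) {μ : Fin d} (h : μ ≠ κ) : flipIdx n κ j μ = j μ := by simp [flipIdx, h]

/-- `flip (flip j) = j`. [folklore] -/
@[simp] theorem flipIdx_flipIdx (j : Fin d → Fin n) : flipIdx n κ (flipIdx n κ j) = j := by
  funext μ; by_cases h : μ = κ
  · subst h; simp
  · simp [h]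

/-- `flip` is bijective. [folklore] -/
theorem flipIdx_bijective : Function.Bijective (flipIdx n κ (d := d)) :=
  Function.Involutive.bijective (flipIdx_flipIdx (n := n) (κ := κ))

/-- value of the flipped coordinate in `ℤ∕(nM_κ)`: `(n − 1 − j : ℕ) = n − 1 − j`. [folklore] -/
theorem cast_rev (j : Fin n) {R : Type} [CommRing R] : (((Fin.rev j : Fin n) : ℕ) : R) = (n : R) - 1 - (j : ℕ) := by
  rw [Fin.val_rev]
  have hj : (j : ℕ) + 1 ≤ n := j.isLt
  rw [Nat.cast_sub hj]; push_cast; ring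

/-- `up` of the coarse reflection is the fine linear reflection of `up`, shifted: `n·σ̃y = torNeg (n·y) − n·e… `; coordinatewise: `n(−1 − y_κ) = −n − n y_κ`. [folklore] -/
theorem up_torRefl (y : Tor M) : up n M (torRefl M κ y) = torNeg (fine n M) κ (up n M y) - tstep (fine n M) κ n := by
  funext ν; by_cases h : ν = κ
  · subst h
    simp only [up, torRefl_apply_same, Pi.sub_apply, torNeg_apply_same, tstep, if_true, map_sub, map_neg]
    have h1 : upHom n M ν (1 : ZMod (M ν)) = (n : ZMod (fine n M ν)) := by
      rw [show (1 : ZMod (M ν)) = ((1 : ℤ) : ZMod (M ν)) by rw [Int.cast_one], B5Block118.upHom_intCast, Int.cast_one, mul_one]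
    rw [h1]; ring
  · simp [up, h, tstep]

/-- ★ **BLOCKS GO TO BLOCKS**: `σ(n·y + j) = n·σ̃y + flip j` — the reflected block point of `(y, j)` is the block point of `(σ̃y, flip j)`. [folklore] -/
theorem torRefl_bpt (y : Tor M) (j : Fin d → Fin n) : torRefl (fine n M) κ (bpt n M y j) = bpt n M (torRefl M κ y) (flipIdx n κ j) := by
  funext ν; by_cases h : ν = κ
  · subst h
    simp only [bpt, Pi.add_apply, torRefl_apply_same, up_torRefl, Pi.sub_apply, torNeg_apply_same, iota, flipIdx_apply_same, cast_rev, tstep,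
      if_true]
    ring
  · simp [bpt, h, iota, up]

end Blocks

/-! ## §2 The reflection operators on scalar functions and on 1-forms -/

section Operators

variable (N : Fin d → ℕ) [∀ μ, NeZero (N μ)] (κ : Fin d)

/-- The scalar reflection `(R⁰f)(x) = f(σx)` as a matrix. [folklore] -/
def reflS : Matrix (Tor N) (Tor N) ℂ := fun x y => if y = torRefl N κ x then 1 else 0

/-- **THE 1-FORM REFLECTION WITH THE BOND TWIST**: `(R¹A)(x, μ) = A(σx, μ)` for `μ ≠ κ` and `(R¹A)(x, κ) = −A(σx − e_κ, κ)` (a `κ`-bond reversed by the mirror starts one step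
lower and changes sign). [cite: Balaban1984PropagatorsI, (1.1) p.18 («A_{⟨x,x′⟩} = −A_{⟨x′,x⟩}»)] -/
def reflV : Matrix (Tor N × Fin d) (Tor N × Fin d) ℂ := fun i j =>
  if i.2 = κ then (if j = (torRefl N κ i.1 - unitVec N κ, κ) then -1 else 0) else (if j = (torRefl N κ i.1, i.2) then 1 else 0)

variable {N κ}

/-- `(R⁰f)(x) = f(σx)`. [folklore] -/
theorem reflS_mulVec (f : Tor N → ℂ) (x : Tor N) : (reflS N κ *ᵥ f) x = f (torRefl N κ x) := by
  simp only [Matrix.mulVec, dotProduct, reflS, ite_mul, one_mul, zero_mul, Finset.sum_ite_eq', Finset.mem_univ, if_true]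

/-- `(R¹A)(x, μ)`: the bond-twisted pull-back. [folklore] -/
theorem reflV_mulVec (A : Tor N × Fin d → ℂ) (x : Tor N) (μ : Fin d) :
    (reflV N κ *ᵥ A) (x, μ) = if μ = κ then -A (torRefl N κ x - unitVec N κ, κ) else A (torRefl N κ x, μ) := by
  simp only [Matrix.mulVec, dotProduct, reflV]
  split_ifs with h
  · simp only [ite_mul, neg_mul, one_mul, zero_mul, Finset.sum_ite_eq', Finset.mem_univ, if_true]
  · simp only [ite_mul, one_mul, zero_mul, Finset.sum_ite_eq', Finset.mem_univ, if_true]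

/-- `(R¹A)(x, κ) = −A(σx − e_κ, κ)`. [folklore] -/
theorem reflV_mulVec_same (A : Tor N × Fin d → ℂ) (x : Tor N) : (reflV N κ *ᵥ A) (x, κ) = -A (torRefl N κ x - unitVec N κ, κ) := by
  rw [reflV_mulVec, if_pos rfl]

/-- `(R¹A)(x, μ) = A(σx, μ)` for `μ ≠ κ`. [folklore] -/
theorem reflV_mulVec_ne (A : Tor N × Fin d → ℂ) (x : Tor N) {μ : Fin d} (h : μ ≠ κ) : (reflV N κ *ᵥ A) (x, μ) = A (torRefl N κ x, μ) := by
  rw [reflV_mulVec, if_neg h]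

/-- `R⁰R⁰ = 1`. [folklore] -/
theorem reflS_mul_reflS : reflS N κ * reflS N κ = 1 := by
  refine matrix_eq_of_mulVec_eq fun f => ?_
  funext x
  rw [← Matrix.mulVec_mulVec, reflS_mulVec, reflS_mulVec, torRefl_torRefl, Matrix.one_mulVec]

omit [∀ μ, NeZero (N μ)] in
/-- the twisted image point is involutive: `σ(σx − e_κ) − e_κ = x`. [folklore] -/
theorem torRefl_sub_unitVec_torRefl_sub (x : Tor N) : torRefl N κ (torRefl N κ x - unitVec N κ) - unitVec N κ = x := by
  rw [torRefl_sub_unitVec_same, torRefl_torRefl, add_sub_cancel_right]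

/-- `R¹R¹ = 1`. [folklore] -/
theorem reflV_mul_reflV : reflV N κ * reflV N κ = 1 := by
  refine matrix_eq_of_mulVec_eq fun A => ?_
  funext i; obtain ⟨x, μ⟩ := i
  rw [← Matrix.mulVec_mulVec, Matrix.one_mulVec]
  by_cases h : μ = κ
  · subst h; rw [reflV_mulVec_same, reflV_mulVec_same, torRefl_sub_unitVec_torRefl_sub, neg_neg]
  · rw [reflV_mulVec_ne _ _ h, reflV_mulVec_ne _ _ h, torRefl_torRefl]

omit [∀ μ, NeZero (N μ)] in
/-- `R⁰` is real. [folklore] -/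
theorem isReal_reflS : IsReal (reflS N κ) := fun x y => by unfold reflS; split_ifs <;> simp

omit [∀ μ, NeZero (N μ)] in
/-- `R¹` is real. [folklore] -/
theorem isReal_reflV : IsReal (reflV N κ) := fun i j => by unfold reflV; split_ifs <;> simp

omit [∀ μ, NeZero (N μ)] in
/-- `R⁰` is symmetric. [folklore] -/
theorem reflS_transpose : (reflS N κ)ᵀ = reflS N κ := by
  ext x y
  simp only [Matrix.transpose_apply, reflS]
  by_cases h : x = torRefl N κ y
  · rw [if_pos h, if_pos (by rw [h, torRefl_torRefl])]
  · rw [if_neg h, if_neg (fun h' => h (by rw [h', torRefl_torRefl]))]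

omit [∀ μ, NeZero (N μ)] in
/-- `R¹` is symmetric (the twist sign depends on the component only, which the image map preserves). [folklore] -/
theorem reflV_transpose : (reflV N κ)ᵀ = reflV N κ := by
  ext i j; obtain ⟨x, μ⟩ := i; obtain ⟨y, ν⟩ := j
  simp only [Matrix.transpose_apply, reflV, Prod.mk.injEq]
  by_cases hμ : μ = κ
  · subst hμ
    by_cases hν : ν = μ
    · subst hν
      simp only [if_true, and_true]
      by_cases h : x = torRefl N ν y - unitVec N ν
      · rw [if_pos h, if_pos (by rw [h, torRefl_sub_unitVec_torRefl_sub])]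
      · rw [if_neg h, if_neg (fun h' => h (by rw [h', torRefl_sub_unitVec_torRefl_sub]))]
    · rw [if_neg hν, if_pos rfl, if_neg, if_neg] <;> (rintro ⟨-, h2⟩; first | exact hν h2 | exact hν h2.symm)
  · rw [if_neg hμ]
    by_cases hν : ν = κ
    · subst hν
      rw [if_pos rfl, if_neg, if_neg] <;> (rintro ⟨-, h2⟩; first | exact hμ h2 | exact hμ h2.symm)
    · rw [if_neg hν]
      by_cases h : x = torRefl N κ y ∧ μ = ν
      · rw [if_pos h, if_pos ⟨by rw [h.1, torRefl_torRefl], h.2.symm⟩]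
      · rw [if_neg h, if_neg (fun h' => h ⟨by rw [h'.1, torRefl_torRefl], h'.2.symm⟩)]

omit [∀ μ, NeZero (N μ)] in
/-- `(R⁰)ᴴ = R⁰`. [folklore] -/
theorem reflS_conjTranspose : (reflS N κ)ᴴ = reflS N κ := by
  rw [(B5RealFields.isReal_iff_conjTranspose).mp isReal_reflS, reflS_transpose]

omit [∀ μ, NeZero (N μ)] in
/-- `(R¹)ᴴ = R¹`. [folklore] -/
theorem reflV_conjTranspose : (reflV N κ)ᴴ = reflV N κ := by
  rw [(B5RealFields.isReal_iff_conjTranspose).mp isReal_reflV, reflV_transpose]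

/-- transport of an equivariance through adjoints: `R₁X = XR₂` gives `R₂Xᴴ = XᴴR₁` for symmetric real involutions. [folklore] -/
theorem conjTranspose_comm_of_comm {m k : Type} [Fintype m] [Fintype k] {R₁ : Matrix m m ℂ} {R₂ : Matrix k k ℂ} {X : Matrix m k ℂ}
    (h₁ : R₁ᴴ = R₁) (h₂ : R₂ᴴ = R₂) (h : R₁ * X = X * R₂) : R₂ * Xᴴ = Xᴴ * R₁ := by
  have := congrArg Matrix.conjTranspose h
  rw [Matrix.conjTranspose_mul, Matrix.conjTranspose_mul, h₁, h₂] at this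
  exact this.symm

end Operators

end Summit.QuantumFields.YangMills.BalabanUVNodes.N15.TwoGrid
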